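import Literature.IUT.HodgeArakelov.MonoThetaFromGroupsProofs3
import Literature.IUT.HodgeArakelov.EtaleThetaDataOfSetting
import Literature.IUT.HodgeArakelov.EtaleThetaDataOfSettingCor218i
import HarnessLib

/-!
# [IUTchII] Prop 1.4 over the genuine [EtTh] model, II: closing half over the construction of record

abc-iut cell, node **IUTchII:Prop1.4** (D-0067 cone of [IUTchIII] Cor 3.12), L6-lead §F v1.8 (3) split: (A) the
CONSTRUCTION of the [IUTchII] Prop. 1.4 output `EtaleThetaData S (Pi C)` at `Π := Π^tp_{X̲̲}` over abc-iut-L2-t8's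
`C : E.DoubleUnderline l` is abc-iut-L6-t1's `EtaleThetaDataOfSetting.lean` (`etaleThetaDataOfSetting'`, orbit of ONE
`l`-th root, named input (H1) `PiYddCharacteristic C`, parameters `S`, `eS : Pi C ≃ₜ* S.PiX`, `S.l = l`); (B) THIS
file, the closing half (the self-contained twin `MonoThetaFromGroupsProofs3.lean`, namespace `EtaleThetaDataOfEtTh`,
landed in the same commit; §C below records that the two agree on `Π_Ÿ(Π)`, `(l·Δ_Θ)(Π)` and the cohomology system).
S. Mochizuki, *Inter-universal Teichmüller theory II*, kurims manuscript (Dec. 2020), §1, Prop. 1.4 p. 27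
[claim: Mochizuki2012, status: disputed] (IUTchII §1 Prop 1.4, kurims p.27); [EtTh] = Publ. RIMS **45** (2009)
[cite: MochizukiEtTh2009, Def 2.7 p.41].

* (b1) **the [IUTchII] §1 setting IS abc-iut-L6-d6's `ThetaSetting.ofDoubleUnderline`** (MERGE-MAP B8 part 3): its
  `PiX` is `TopGroup.of ↥C.Huu = Pi C` ON THE NOSE, so `eS := ContinuousMulEquiv.refl _` and `S.l = l` by `rfl` —
  `etaleThetaDataOfDoubleUnderline` (reference subgroup = `Π^tp_{Ÿ̲̲}` itself = L2-t8's `thetaEnvData.PiYdd`,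
  `etaleThetaDataOfDoubleUnderline_PiYddRef`), and for EVERY `Π ≅ Π^tp_{X̲̲_k}` by transport
  (`EtaleThetaData.comap` of part I): `etaleThetaDataOfDoubleUnderlineOf`;
* (b2) **(H1) BY NAME**: `PiYddCharacteristic C` is the `Π^tp_Ÿ` conjunct of abc-iut-L2-t2's named fact
  `RigidData.Cor218_i` ([EtTh] Cor. 2.18 (i); FACT-LIST F-0620, admissible) at L2-t8's `C.rigidData` —
  abc-iut-w4-d013's landed `EtaleThetaDataOfSetting.piYddCharacteristic_of_cor218_i` (imported); hence
  `etaleThetaDataOfCor218`, `etaleThetaDataOfCor218Of`, conditional on [EtTh] Cor. 2.18 (i) + Prop. 1.5 (iii) by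
  name and on nothing else;
* (b3) **faithfulness of the orbit datum** ("the `(l·ℤ × μ_2)`-orbit `η̈^{Θ,l·ℤ×μ_2}` of an `l`-th root of the étale
  theta function"): under `H¹(Π^tp_{Ÿ̲̲}, l·Δ_Θ) → H¹(Π^tp_{Ÿ̲̲}, Δ_Θ)` (`toBaseH1`, forgetting `l·Δ_Θ`-integrality) L6-t1's
  one-root class `rootLiftClass ↦ η̈^Θ|_{Π^tp_{Ÿ̲̲}}` (`toBaseH1_rootLiftClass`: `η̲̈^Θ` IS an `l`-th ROOT of abc-iut-L2-t1's
  étale theta class) and `orbitOne` maps ONTO L2-t8's `DoubleUnderline.etaOrbit` (`image_toBaseH1_orbitOne`), the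
  `(l·ℤ × μ_2)`-orbit of [EtTh] p. 41 whose `l·Δ_Θ`-valued cocycles reduce modulo `N` to the theta sections of the
  model mono-theta environment ([EtTh] Def. 2.13 (ii)(c)) = the reference model of `ThetaSetting.ofDoubleUnderline`
  (`baseCocycle_mem_rootCocycles`, `modN_rootLift_mem_thetaCocycles`): the `θ(Π)`-datum of Prop. 1.4 and the
  `s^Θ`-datum of Def. 1.1 come from the SAME cocycles; "of standard type" ([EtTh] Def. 1.9 (ii) / 2.7) is a
  normalisation of the INPUT class `E.etaDd`: when the [EtTh] §1 setting is a `MuTwoSetting` ([EtTh] Def. 1.7) it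
  is LITERALLY L2-t8's `MuTwoSetting.OrbitsOfStandardType C hC εZ S := M.IsOfStandardType hC εZ S E.etaDd`
  (`StandardEnvOfSetting.lean`, [EtTh] Def. 2.7: the orbits `η̲̈^{Θ,l·ℤ×μ_2}`, … "are of standard type" iff `η̈^{Θ,ℤ}` is) —
  a hypothesis on the input (data `εZ`, `StandardData` that the `ThetaSetting`-level bridge does not carry), exactly
  as for L2-t8's `thetaEnvData` / Def. 2.13 (iv) `IsModelBiOfStandardType`; nothing to construct or re-encode here;
* (b4) `∞θ(Π) ⊇` the image of `θ(Π)` (multiple `1`), over the interface (`EtaleThetaData.toLim_mem_thetaInfty`).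

HONEST FRAMING: bookkeeping over Mathlib + landed files; nothing of [IUTchII] is asserted (claim key `Mochizuki2012`,
D-0012, disputed); [EtTh] is refereed; no side is taken on [IUTchIII] Cor. 3.12; typed ≠ proved.
-/

noncomputable section

namespace Literature.IUT.HodgeArakelov

open Literature.AnabelianGeometry.EtaleTheta

universe u

/-! ## Part A. `∞θ(Π)` over the interface (b4) -/

namespace EtaleThetaData

variable {S : ThetaSetting.{u}} {P : TopGroup.{u}}

/-- **`∞θ(Π) ⊇` the image of `θ(Π)`** ("the subset of elements of `lim_J H¹(…)` for which some [positive integer]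
multiple coincides, up to torsion, with an element of `θ(Π)`": take the multiple `1`). Over the interface.
[claim: Mochizuki2012, status: disputed] (IUTchII §1 Prop 1.4, kurims p.27) -/
theorem toLim_mem_thetaInfty (X : EtaleThetaData S P) {t : X.coh.H1 ⊤} (ht : t ∈ X.theta) :
    X.coh.toLim ⊤ t ∈ X.thetaInfty :=
  ⟨1, Nat.one_pos, t, ht, by rw [one_smul, sub_self]; exact IsOfFinAddOrder.zero⟩

/-- In particular `∞θ(Π)` is nonempty. [claim: Mochizuki2012, status: disputed] (IUTchII §1 Prop 1.4, kurims p.27) -/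
theorem thetaInfty_nonempty (X : EtaleThetaData S P) : X.thetaInfty.Nonempty := by
  obtain ⟨t, ht⟩ := X.theta_nonempty
  exact ⟨_, X.toLim_mem_thetaInfty ht⟩

end EtaleThetaData

/-! ## Part B. Closing half of the node over abc-iut-L6-t1's construction `EtaleThetaDataOfSetting` -/

namespace EtaleThetaDataOfSetting

variable {p : ℕ} [Fact p.Prime] {D : Literature.AnabelianGeometry.EtaleTheta.ThetaSetting p}
  {E : D.EtaleThetaData} {l : ℕ} (C : E.DoubleUnderline l)

/-! ### (b2) `Π_Ÿ(Π)` bookkeeping; the hypothesis `PiYddCharacteristic` IS [EtTh] Cor. 2.18 (i) (abc-iut-w4-d013, imported) -/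

/-- `Π_Ÿ(Π) = Π^tp_Ÿ̲̲ ⊆ Π^tp_X̲̲` is L2-t8's `thetaEnvData.PiYdd` (the two ways of writing `Π^tp_Ÿ ∩ Π^tp_X̲̲` inside
`Π^tp_X̲̲`). [cite: MochizukiEtTh2009, Def 2.13 p.47] -/
theorem piYdd_eq_subgroupOf : PiYdd C = D.GtpYdd.subgroupOf C.Huu :=
  Subgroup.inf_subgroupOf_right D.GtpYdd C.Huu

/-! (H1) `PiYddCharacteristic C` from [EtTh] Cor. 2.18 (i) BY NAME is abc-iut-w4-d013's landed
`EtaleThetaDataOfSetting.piYddCharacteristic_of_cor218_i` (`EtaleThetaDataOfSettingCor218i.lean`, p412812; FACT-LIST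
F-0620, admissible) — imported, not restated. -/

/-! ### (b1) The [IUTchII] §1 setting IS abc-iut-L6-d6's `ThetaSetting.ofDoubleUnderline` (`eS := refl`, `S.l = l` by `rfl`) -/

section OfDoubleUnderline

variable {N : ℕ+} (μ : D.CyclotomeMod l N) (hC : D.Compat) (hS : D.Sec2Hyps)
  (hl : l.Prime) (hp2 : p ≠ 2) (hpl : p ≠ l) (hζ : ∃ ζ : D.K, IsPrimitiveRoot ζ (4 * l))
  {η : (C.thetaEnvData μ hC hS).PiYdd → MuN p N} (hη : η ∈ (C.thetaEnvData μ hC hS).thetaCocycles)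

/-- **[IUTchII] Prop. 1.4 for the genuine group `Π = Π^tp_{X̲̲_k}`** of the [IUTchII] §1 setting `ThetaSetting.ofDoubleUnderline`
determined by the [EtTh] data (MERGE-MAP B8 part 3): L6-t1's construction `etaleThetaDataOfSetting'` (orbit of ONE
`l`-th root) with `S.PiX = Π^tp_{X̲̲}` ON THE NOSE — `eS := ContinuousMulEquiv.refl`, `S.l = l` by `rfl` — under the
single named input (H1) `PiYddCharacteristic C`. [claim: Mochizuki2012, status: disputed] (IUTchII §1 Prop 1.4, kurims p.27) -/
def etaleThetaDataOfDoubleUnderline (hchar : PiYddCharacteristic C) :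
    EtaleThetaData (ThetaSetting.ofDoubleUnderline C μ hC hS hl hp2 hpl hζ hη)
      (ThetaSetting.ofDoubleUnderline C μ hC hS hl hp2 hpl hζ hη).PiX :=
  etaleThetaDataOfSetting' C hC hS hchar (ThetaSetting.ofDoubleUnderline C μ hC hS hl hp2 hpl hζ hη)
    (ContinuousMulEquiv.refl _) rfl

/-- Its reference subgroup `Π^tp_{Ÿ̲_k} ⊆ Π^tp_{X̲̲_k}` is `Π^tp_Ÿ̲̲` itself (no transport): L2-t8's `thetaEnvData.PiYdd`.
[cite: MochizukiEtTh2009, Def 2.13 p.47] -/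
theorem etaleThetaDataOfDoubleUnderline_PiYddRef (hchar : PiYddCharacteristic C) :
    (etaleThetaDataOfDoubleUnderline C μ hC hS hl hp2 hpl hζ hη hchar).PiYddRef = (C.thetaEnvData μ hC hS).PiYdd :=
  (Subgroup.map_id _).trans (piYdd_eq_subgroupOf C)

/-- Its `Π_Ÿ(Π)` is `Π^tp_Ÿ̲̲`. [cite: MochizukiEtTh2009, Def 2.13 p.47] -/
theorem etaleThetaDataOfDoubleUnderline_PiYdd (hchar : PiYddCharacteristic C) :
    (etaleThetaDataOfDoubleUnderline C μ hC hS hl hp2 hpl hζ hη hchar).PiYdd = (C.thetaEnvData μ hC hS).PiYdd :=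
  piYdd_eq_subgroupOf C

/-- Its orbit is the one-root orbit and `θ(Π)` is read with the covering's `l`.
[claim: Mochizuki2012, status: disputed] (IUTchII §1 Prop 1.4, kurims p.27) -/
theorem etaleThetaDataOfDoubleUnderline_theta (hchar : PiYddCharacteristic C) :
    (etaleThetaDataOfDoubleUnderline C μ hC hS hl hp2 hpl hζ hη hchar).theta =
      {b | ∃ o ∈ orbitOne C hC, l • (b + o) = 0} :=
  etaleThetaDataOfSetting'_theta C hC hS hchar _ _ rfl

/-- **[IUTchII] Prop. 1.4 for every `Π ≅ Π^tp_{X̲̲_k}`** ("`Π` a topological group isomorphic to `Π^tp_{X̲̲_k}`"): the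
output for `Π^tp_{X̲̲_k}` transported along the given isomorphism (functoriality, Part A).
[claim: Mochizuki2012, status: disputed] (IUTchII §1 Prop 1.4, kurims p.27) -/
def etaleThetaDataOfDoubleUnderlineOf {P : TopGroup.{0}} (hchar : PiYddCharacteristic C)
    (e : P ≃ₜ* (ThetaSetting.ofDoubleUnderline C μ hC hS hl hp2 hpl hζ hη).PiX) :
    EtaleThetaData (ThetaSetting.ofDoubleUnderline C μ hC hS hl hp2 hpl hζ hη) P :=
  (etaleThetaDataOfDoubleUnderline C μ hC hS hl hp2 hpl hζ hη hchar).comap e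

/-- **… modulo [EtTh] Cor. 2.18 (i) BY NAME** (and [EtTh] Prop. 1.5 (iii), on which L2-t8's `rigidData` depends):
the Prop. 1.4 output for `Π^tp_{X̲̲_k}` with (H1) discharged from `RigidData.Cor218_i`.
[claim: Mochizuki2012, status: disputed] (IUTchII §1 Prop 1.4, kurims p.27) -/
def etaleThetaDataOfCor218 (h15 : D.Prop15iii E hC) (L : C.CuspLabels)
    (h218 : (C.rigidData μ hC hS h15 L).Cor218_i) :
    EtaleThetaData (ThetaSetting.ofDoubleUnderline C μ hC hS hl hp2 hpl hζ hη)
      (ThetaSetting.ofDoubleUnderline C μ hC hS hl hp2 hpl hζ hη).PiX :=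
  etaleThetaDataOfDoubleUnderline C μ hC hS hl hp2 hpl hζ hη
    (piYddCharacteristic_of_cor218_i C μ hC hS h15 L (C.rigidData μ hC hS h15 L) rfl h218)

/-- … and for every `Π ≅ Π^tp_{X̲̲_k}`. [claim: Mochizuki2012, status: disputed] (IUTchII §1 Prop 1.4, kurims p.27) -/
def etaleThetaDataOfCor218Of {P : TopGroup.{0}} (h15 : D.Prop15iii E hC) (L : C.CuspLabels)
    (h218 : (C.rigidData μ hC hS h15 L).Cor218_i)
    (e : P ≃ₜ* (ThetaSetting.ofDoubleUnderline C μ hC hS hl hp2 hpl hζ hη).PiX) :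
    EtaleThetaData (ThetaSetting.ofDoubleUnderline C μ hC hS hl hp2 hpl hζ hη) P :=
  (etaleThetaDataOfCor218 C μ hC hS hl hp2 hpl hζ hη h15 L h218).comap e

end OfDoubleUnderline

/-! ### (b3) Faithfulness: the one-root class IS an `l`-th root of `η̈^Θ|_{Ÿ̲̲}`, its orbit IS [EtTh]'s `η̲̈^{Θ,l·ℤ×μ_2}` -/

/-- From the copy `Π^tp_{Ÿ̲̲} ⊆ Π^tp_X` to the copy `Π^tp_{Ÿ̲̲} ∩ ⊤ ⊆ Π^tp_{X̲̲}` (inverse of L6-t1's `toYdduu C ⊤`).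
[cite: MochizukiEtTh2009, Def 2.7 p.41] -/
def toYddTop : C.GtpYdduu →* ↥(PiYdd C ⊓ ⊤) where
  toFun g := ⟨⟨(g : D.PiTemp), (Subgroup.mem_inf.1 g.2).2⟩, Subgroup.mem_inf.2 ⟨Subgroup.mem_subgroupOf.2 g.2, trivial⟩⟩
  map_one' := rfl
  map_mul' _ _ := rfl

/-- `toYddTop` is continuous. [cite: MochizukiEtTh2009, Def 2.7 p.41] -/
theorem continuous_toYddTop : Continuous (toYddTop C) :=
  Continuous.subtype_mk (Continuous.subtype_mk continuous_subtype_val _) _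

/-- `toYdduu ∘ toYddTop = id`. [cite: MochizukiEtTh2009, Def 2.7 p.41] -/
@[simp] theorem toYdduu_toYddTop (g : C.GtpYdduu) : toYdduu C ⊤ (toYddTop C g) = g := rfl

/-- `toYddTop` does not change the underlying element of `Π^tp_X`. [cite: MochizukiEtTh2009, Def 2.7 p.41] -/
@[simp] theorem coe_coe_toYddTop (g : C.GtpYdduu) : (((toYddTop C g : ↥(PiYdd C ⊓ ⊤)) : Pi C) : D.PiTemp) = (g : D.PiTemp) :=
  rfl

/-- Forgetting `l·Δ_Θ`-integrality at the level of cocycles: an `l·Δ_Θ`-valued cocycle on `Π^tp_{Ÿ̲̲} ∩ ⊤ ⊆ Π^tp_{X̲̲}`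
gives a `Δ_Θ`-valued cocycle on `Π^tp_{Ÿ̲̲} ⊆ Π^tp_X` (the map `H¹(Π^tp_{Ÿ̲̲}, l·Δ_Θ) → H¹(Π^tp_{Ÿ̲̲}, Δ_Θ)` induced by
`l·Δ_Θ ⊆ Δ_Θ`, [EtTh] p. 41; left inverse to L6-t1's `liftCocycle C ⊤`). [cite: MochizukiEtTh2009, Def 2.7 p.41] -/
def baseCocycle :
    contCocycles (phi C) (D.lDeltaTheta l) (PiYdd C ⊓ ⊤) →* contCocycles D.toTheta D.DeltaTheta C.GtpYdduu where
  toFun F := ⟨fun g => ⟨(F.1 (toYddTop C g) : D.GtpTheta), D.lDeltaTheta_le l (F.1 (toYddTop C g)).2⟩, by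
    refine ⟨?_, fun g h => ?_⟩
    · exact Continuous.subtype_mk
        (continuous_subtype_val.comp (F.2.1.comp (continuous_toYddTop C))) _
    · apply Subtype.ext
      have e2 := congrArg (fun x : D.lDeltaTheta l => (x : D.GtpTheta)) (F.2.2 (toYddTop C g) (toYddTop C h))
      simp only [Subgroup.coe_mul, MulAut.conjNormal_apply] at e2
      rw [Subgroup.coe_mul, MulAut.conjNormal_apply]
      exact e2⟩
  map_one' := rfl
  map_mul' _ _ := rfl

/-- **`H¹(Π^tp_{Ÿ̲̲}, l·Δ_Θ) → H¹(Π^tp_{Ÿ̲̲}, Δ_Θ)`**, induced by `l·Δ_Θ ⊆ Δ_Θ` (and the identification of the two copies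
of `Π^tp_{Ÿ̲̲}`). [cite: MochizukiEtTh2009, Def 2.7 p.41] -/
def toBaseH1 : ContH1 (phi C) (D.lDeltaTheta l) (PiYdd C ⊓ ⊤) →* D.H1 C.GtpYdduu :=
  QuotientGroup.map _ _ (baseCocycle C) (by
    intro F hF
    obtain ⟨a, ha⟩ := (mem_contCoboundaries_iff _).mp (Subgroup.mem_subgroupOf.mp hF)
    refine Subgroup.mem_subgroupOf.mpr ((mem_contCoboundaries_iff _).mpr
      ⟨⟨(a : D.GtpTheta), D.lDeltaTheta_le l a.2⟩, ?_⟩)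
    funext g
    apply Subtype.ext
    exact congrArg (fun x : D.lDeltaTheta l => (x : D.GtpTheta)) (congrFun ha (toYddTop C g)))

/-- **`η̲̈^Θ ↦ η̈^Θ|_{Π^tp_{Ÿ̲̲}}`**: L6-t1's one-root class `rootLiftClass` maps to the restriction of abc-iut-L2-t1's
étale theta class `E.etaDd` ([EtTh] p. 41: "the class `η̈^Θ` determines a class `η̲̈^Θ ∈ H¹(Π^tp_Ÿ̲̲, l·Δ_Θ)`"; with the
multiplicative coefficients used here: `η̲̈^Θ` IS [the Kummer class of] an `l`-th ROOT of the étale theta function).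
[cite: MochizukiEtTh2009, Def 2.7 p.41] -/
theorem toBaseH1_rootLiftClass :
    toBaseH1 C (rootLiftClass C) = ContH1.res D.toTheta D.DeltaTheta inf_le_left E.etaDd := by
  rw [← rootLift_mk C]
  rfl

/-- Conjugating inside `Π^tp_{X̲̲}` then forgetting integrality = forgetting, conjugating inside `Π^tp_X` and
restricting to `Ÿ̲̲`: for `σ ∈ Π^tp_{X̲̲}`, if `F ↦ G|_{Ÿ̲̲}` then `σ·F ↦ (σ·G)|_{Ÿ̲̲}` (cocycle bookkeeping for the
comparison of the two orbits). [cite: MochizukiEtTh2009, Def 2.7 p.41] -/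
theorem toBaseH1_conj_mk (hC : D.Compat) (σ : Pi C)
    (F : contCocycles (phi C) (D.lDeltaTheta l) (PiYdd C ⊓ ⊤))
    (G : contCocycles D.toTheta D.DeltaTheta D.GtpYdd)
    (h : toBaseH1 C (QuotientGroup.mk F) =
      ContH1.res D.toTheta D.DeltaTheta inf_le_left (QuotientGroup.mk G : D.H1 D.GtpYdd)) :
    haveI := piYdd_normal C hC
    haveI := hC.GtpYdd_normal
    toBaseH1 C (ContH1.conj (phi C) (D.lDeltaTheta l) σ (QuotientGroup.mk F)) =
      ContH1.res D.toTheta D.DeltaTheta inf_le_left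
        (ContH1.conj D.toTheta D.DeltaTheta (σ : D.PiTemp) (QuotientGroup.mk G : D.H1 D.GtpYdd)) := by
  haveI := piYdd_normal C hC
  haveI := hC.GtpYdd_normal
  -- unpack the hypothesis: `(base F)⁻¹ * res G` is the coboundary of some `a ∈ Δ_Θ`
  change (QuotientGroup.mk (baseCocycle C F) : D.H1 C.GtpYdduu) =
    QuotientGroup.mk (ContH1.resCocycle D.toTheta D.DeltaTheta inf_le_left G) at h
  rw [QuotientGroup.eq, Subgroup.mem_subgroupOf, mem_contCoboundaries_iff] at h
  obtain ⟨a, ha⟩ := h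
  -- the goal, at the level of cocycles
  change (QuotientGroup.mk (baseCocycle C (ContH1.conjCocycle (phi C) (D.lDeltaTheta l) σ F)) :
      D.H1 C.GtpYdduu) =
    QuotientGroup.mk (ContH1.resCocycle D.toTheta D.DeltaTheta inf_le_left
      (ContH1.conjCocycle D.toTheta D.DeltaTheta (σ : D.PiTemp) G))
  rw [QuotientGroup.eq, Subgroup.mem_subgroupOf, mem_contCoboundaries_iff]
  refine ⟨MulAut.conjNormal (D.toTheta (σ : D.PiTemp)) a, ?_⟩
  funext x
  -- the point `σ⁻¹ x σ ∈ Π^tp_{Ÿ̲̲}`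
  have hx' : (σ : D.PiTemp)⁻¹ * (x : D.PiTemp) * (σ : D.PiTemp)⁻¹⁻¹ ∈ C.GtpYdduu := by
    refine Subgroup.mem_inf.2 ⟨hC.GtpYdd_normal.conj_mem _ (Subgroup.mem_inf.1 x.2).1 _, ?_⟩
    rw [inv_inv]
    exact C.Huu.mul_mem (C.Huu.mul_mem (C.Huu.inv_mem σ.2) (Subgroup.mem_inf.1 x.2).2) σ.2
  set x' : C.GtpYdduu := ⟨_, hx'⟩ with hx'def
  have I1 : toYddTop C x' = MulAut.conjNormal σ⁻¹ (toYddTop C x) := by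
    apply Subtype.ext; apply Subtype.ext
    rw [MulAut.conjNormal_apply]
    rfl
  have I2 : (⟨(x' : D.PiTemp), (Subgroup.mem_inf.1 x'.2).1⟩ : D.GtpYdd) =
      MulAut.conjNormal (σ : D.PiTemp)⁻¹ ⟨x, (Subgroup.mem_inf.1 x.2).1⟩ := by
    apply Subtype.ext
    rw [MulAut.conjNormal_apply]
  have e1 : (((baseCocycle C (ContH1.conjCocycle (phi C) (D.lDeltaTheta l) σ F)).1 x :
      D.DeltaTheta) : D.GtpTheta) =
        D.toTheta σ * (F.1 (toYddTop C x') : D.GtpTheta) * (D.toTheta σ)⁻¹ := by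
    change (((ContH1.conjCocycle (phi C) (D.lDeltaTheta l) σ F).1 (toYddTop C x) :
      D.lDeltaTheta l) : D.GtpTheta) = _
    rw [show (ContH1.conjCocycle (phi C) (D.lDeltaTheta l) σ F).1 (toYddTop C x) =
        MulAut.conjNormal (phi C σ) (F.1 (MulAut.conjNormal σ⁻¹ (toYddTop C x))) from rfl, ← I1,
      MulAut.conjNormal_apply]
    rfl
  have e2 : (((ContH1.resCocycle D.toTheta D.DeltaTheta (inf_le_left : C.GtpYdduu ≤ D.GtpYdd)
      (ContH1.conjCocycle D.toTheta D.DeltaTheta (σ : D.PiTemp) G)).1 x : D.DeltaTheta) : D.GtpTheta) =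
        D.toTheta σ * (G.1 ⟨(x' : D.PiTemp), (Subgroup.mem_inf.1 x'.2).1⟩ : D.GtpTheta) * (D.toTheta σ)⁻¹ := by
    change (((ContH1.conjCocycle D.toTheta D.DeltaTheta (σ : D.PiTemp) G).1
      ⟨(x : D.PiTemp), (Subgroup.mem_inf.1 x.2).1⟩ : D.DeltaTheta) : D.GtpTheta) = _
    rw [show (ContH1.conjCocycle D.toTheta D.DeltaTheta (σ : D.PiTemp) G).1
          ⟨(x : D.PiTemp), (Subgroup.mem_inf.1 x.2).1⟩ =
        MulAut.conjNormal (D.toTheta (σ : D.PiTemp)) (G.1 (MulAut.conjNormal (σ : D.PiTemp)⁻¹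
          ⟨(x : D.PiTemp), (Subgroup.mem_inf.1 x.2).1⟩)) from rfl, ← I2, MulAut.conjNormal_apply]
  have hax := congrFun ha x'
  have hax' := congrArg (fun y : D.DeltaTheta => (y : D.GtpTheta)) hax
  simp only [Pi.mul_apply, Pi.inv_apply, Subgroup.coe_mul, Subgroup.coe_inv, MulAut.conjNormal_apply] at hax'
  change (F.1 (toYddTop C x') : D.GtpTheta)⁻¹ * (G.1 ⟨(x' : D.PiTemp), (Subgroup.mem_inf.1 x'.2).1⟩ : D.GtpTheta)
    = _ at hax'
  apply Subtype.ext
  simp only [Subgroup.coe_mul, Subgroup.coe_inv, Pi.mul_apply, Pi.inv_apply, MulAut.conjNormal_apply]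
  rw [e1, e2]
  have step : (D.toTheta σ * (F.1 (toYddTop C x') : D.GtpTheta) * (D.toTheta σ)⁻¹)⁻¹ *
      (D.toTheta σ * (G.1 ⟨(x' : D.PiTemp), (Subgroup.mem_inf.1 x'.2).1⟩ : D.GtpTheta) * (D.toTheta σ)⁻¹) =
      D.toTheta σ * ((F.1 (toYddTop C x') : D.GtpTheta)⁻¹ *
        (G.1 ⟨(x' : D.PiTemp), (Subgroup.mem_inf.1 x'.2).1⟩ : D.GtpTheta)) * (D.toTheta σ)⁻¹ := by
    group
  rw [step, hax']
  simp only [x', map_mul, map_inv]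
  group

/-- **The one-root orbit of [IUTchII] Prop. 1.4 (L6-t1's `orbitOne`) maps ONTO [EtTh]'s `(l·ℤ × μ_2)`-orbit of
`η̈^Θ|_{Ÿ̲̲}`** (abc-iut-L2-t8's `DoubleUnderline.etaOrbit`) under `coh.H1 ⊤ ≅ H¹(Π^tp_{Ÿ̲̲} ∩ ⊤, l·Δ_Θ) →
H¹(Π^tp_{Ÿ̲̲}, Δ_Θ)`: the orbit datum is [EtTh]'s, read with `l·Δ_Θ`-coefficients.
[cite: MochizukiEtTh2009, Def 2.7 p.41] -/
theorem image_toBaseH1_orbitOne (hC : D.Compat) :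
    (fun y => toBaseH1 C (Additive.toMul (h1Top C y))) '' orbitOne C hC = C.etaOrbit hC := by
  haveI := piYdd_normal C hC
  haveI := hC.GtpYdd_normal
  obtain ⟨G, hG⟩ := QuotientGroup.mk_surjective E.etaDd
  have h0 : toBaseH1 C (QuotientGroup.mk (⟨liftCocycle C ⊤ (rootLift C).1 (rootLift_val C),
      liftCocycle_mem C ⊤ (rootLift C).1 (rootLift C).2 (rootLift_val C)⟩ :
        contCocycles (phi C) (D.lDeltaTheta l) (PiYdd C ⊓ ⊤))) =
      ContH1.res D.toTheta D.DeltaTheta inf_le_left (QuotientGroup.mk G : D.H1 D.GtpYdd) := by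
    rw [hG]; exact toBaseH1_rootLiftClass C
  ext y
  constructor
  · rintro ⟨z, ⟨σ, rfl⟩, rfl⟩
    refine ⟨(σ : D.PiTemp), σ.2, ?_⟩
    dsimp only
    rw [AddEquiv.apply_symm_apply, toMul_ofMul, ← hG]
    exact toBaseH1_conj_mk C hC σ _ G h0
  · rintro ⟨σ, hσ, rfl⟩
    refine ⟨(h1Top C).symm (Additive.ofMul
      (ContH1.conj (phi C) (D.lDeltaTheta l) (⟨σ, hσ⟩ : Pi C) (rootLiftClass C))), ⟨⟨σ, hσ⟩, rfl⟩, ?_⟩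
    dsimp only
    rw [AddEquiv.apply_symm_apply, toMul_ofMul, ← hG]
    exact toBaseH1_conj_mk C hC ⟨σ, hσ⟩ _ G h0

/-- Consequently every `l·Δ_Θ`-valued cocycle whose class lies in `orbitOne` is — after forgetting integrality — one
of abc-iut-L2-t8's `rootCocycles`, i.e. its reduction modulo `N` is a THETA-SECTION datum of the model mono-theta
environment of `X̲̲` ([EtTh] Def. 2.13 (ii)(c); the `s^Θ` of the reference model of the [IUTchII] §1 setting
`ThetaSetting.ofDoubleUnderline`): the `θ(Π)`-datum of Prop. 1.4 and the `s^Θ`-datum of Def. 1.1 come from the SAME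
cocycles. [cite: MochizukiEtTh2009, Def 2.13 p.46] -/
theorem baseCocycle_mem_rootCocycles (hC : D.Compat)
    (F : contCocycles (phi C) (D.lDeltaTheta l) (PiYdd C ⊓ ⊤))
    (hF : (h1Top C).symm (Additive.ofMul (QuotientGroup.mk F :
      ContH1 (phi C) (D.lDeltaTheta l) (PiYdd C ⊓ ⊤))) ∈ orbitOne C hC) :
    baseCocycle C F ∈ C.rootCocycles hC := by
  refine ⟨fun g => (F.1 (toYddTop C g)).2, ?_⟩
  rw [← image_toBaseH1_orbitOne C hC]
  refine ⟨_, hF, ?_⟩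
  dsimp only
  rw [AddEquiv.apply_symm_apply, toMul_ofMul]
  rfl

/-- … in particular the chosen `l`-th root's cocycle reduces, modulo `N`, to a theta cocycle of L2-t8's
`thetaEnvData` (the data of the reference model mono-theta environment of `ThetaSetting.ofDoubleUnderline`).
[cite: MochizukiEtTh2009, Def 2.13 p.46] -/
theorem modN_rootLift_mem_thetaCocycles (hC : D.Compat) (hS : D.Sec2Hyps) {N : ℕ+} (μ : D.CyclotomeMod l N) :
    C.modN μ (rootLift C) (rootLift_val C) ∈ (C.thetaEnvData μ hC hS).thetaCocycles := by
  haveI := hC.GtpYdd_normal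
  refine ⟨rootLift C, ⟨rootLift_val C, 1, one_mem _, ?_⟩, rfl⟩
  rw [Literature.AnabelianGeometry.EtaleTheta.ThetaSetting.EtaleThetaData.DoubleUnderline.contH1_conj_one]
  exact rootLift_mk C

end EtaleThetaDataOfSetting

/-! ## Part C. The two constructions agree (part I's `EtaleThetaDataOfEtTh` vs L6-t1's `EtaleThetaDataOfSetting`) -/

namespace EtaleThetaDataOfEtTh

variable {p : ℕ} [Fact p.Prime] {D : Literature.AnabelianGeometry.EtaleTheta.ThetaSetting p}
  {E : D.EtaleThetaData} {l : ℕ} (C : E.DoubleUnderline l)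

/-- `Π_Ÿ(Π)`: part I's `piYddUU` (`Π^tp_Ÿ ∩ Π^tp_{X̲̲}` via `subgroupOf`) = L6-t1's `PiYdd` (`(Π^tp_Ÿ ∩ Π^tp_{X̲̲}) ∩ Π^tp_{X̲̲}`).
[cite: MochizukiEtTh2009, Def 2.7 p.41] -/
theorem piYddUU_eq_piYdd : piYddUU C = EtaleThetaDataOfSetting.PiYdd C :=
  (EtaleThetaDataOfSetting.piYdd_eq_subgroupOf C).symm

/-- `(l·Δ_Θ)(Π)`: the two subquotients coincide. [cite: MochizukiEtTh2009, Prop 2.12 (i) p.45] -/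
theorem lDeltaThetaUU_eq : lDeltaThetaUU C = EtaleThetaDataOfSetting.lDeltaSubquotient C := rfl

/-- The cohomology systems `J ↦ H¹(Π^tp_{Ÿ̲̲}|_J, l·Δ_Θ)` coincide. [claim: Mochizuki2012, status: disputed] (IUTchII §1 Prop 1.4, kurims p.27) -/
theorem cohUU_eq_coh : cohUU C = EtaleThetaDataOfSetting.coh C := by
  unfold cohUU
  rw [piYddUU_eq_piYdd]

/-- Both one-root classes forget to the SAME base class `η̈^Θ|_{Π^tp_{Ÿ̲̲}}` (part I's `etaRoot` via part I's orbit map is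
in L2-t8's `etaOrbit`; here: the two chosen lifts are the same cocycle of `C.eta_res`).
[cite: MochizukiEtTh2009, Def 2.7 p.41] -/
theorem rootCocycle_apply (g : piYddUU C) :
    ((rootCocycle C).1 g : D.GtpTheta) = (EtaleThetaDataOfSetting.rootLift C).1 (C.inclYdduu g) := rfl

end EtaleThetaDataOfEtTh

end Literature.IUT.HodgeArakelov

end
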